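import Literature.ModelTheory.Quasiminimal.ClassEmbeddings
import Literature.ModelTheory.Quasiminimal.CrownEmbeddings
import HarnessLib

/-!
# Crown embeddings inside a member of a quasiminimal pregeometry class

The one-structure theorem `IsWeaklyQuasiminimalPregeometryStructure.exists_equiv_extend_crown`
(`CrownEmbeddings.lean`: Kirby 2010, Lemma 3.2 in automorphism form, from BHHKK 2014, Prop. 6.2)
is stated for a countable structure `M` with a basis `b : ℕ → M`. In the proof of the uniqueness
of large models (Kirby 2010, Thm 3.3) it is applied to the countable closed subsets
`cl_H(G ∪ X)` of an arbitrary member `H` of the class. This file performs that transfer: for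
`⟨H, cl⟩` in a quasiminimal pregeometry class and an independent family `w : ℕ → H`, the closed
set `cl (range w)` with the induced structure and the restricted closure is a member of the
class (Haykazyan's axiom (3ii)), a countable weakly quasiminimal pregeometry structure with basis
`w`, and quantifier-free types, partial embeddings, faces and crowns computed in the substructure
agree with those computed in `H`. Consequence:

* `IsQuasiminimalPregeometryClass.exists_isPartialEmbOn_extend_crown` — a partial embedding of
  `H` into itself defined on the crown `⋃_{i ∈ S} cl (w[ℕ ∖ {i}])` (`S ≠ ∅` finite), mapping each
  of these faces onto itself and fixing every `w j`, extends to a bijection `Γ` of `H` which is a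
  partial embedding on `cl (range w)` mapping it onto itself, and is the identity outside.

## References

* J. Kirby, *On quasiminimal excellent classes*, J. Symbolic Logic 75 (2010): Lemma 3.2,
  Thm 3.3 (proof).
* L. Haykazyan, *Categoricity in quasiminimal pregeometry classes*, J. Symbolic Logic 81 (2016):
  Def. 2 (3ii), Prop. 4.
* M. Bays, B. Hart, T. Hyttinen, M. Kesälä, J. Kirby, *Quasiminimal structures and excellence*,
  Bull. LMS 46 (2014): Prop. 6.2.
-/

noncomputable section

open Set
open FirstOrder FirstOrder.Language

universe u v w

namespace Literature.ModelTheory.Quasiminimal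

/-! ### Quantifier-free types and partial embeddings in a substructure -/

section Substructure

variable {L : Language.{v, w}} {H : Type u} [L.Structure H] (S : L.Substructure H)

/-- Atomic formulas are evaluated in a substructure as in the ambient structure. [folklore] -/
theorem realize_iff_of_isAtomic_substructure {α : Type*} {φ : L.Formula α} (hφ : φ.IsAtomic)
    (v : α → S) : φ.Realize (Subtype.val ∘ v : α → H) ↔ φ.Realize v := by
  have := (BoundedFormula.IsQF.of_isAtomic hφ).realize_embedding S.subtype (v := v)
    (xs := (default : Fin 0 → S))
  rw [show ((S.subtype : S → H) ∘ (default : Fin 0 → S)) = default from Subsingleton.elim _ _,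
    Substructure.coe_subtype] at this
  exact this

/-- **Quantifier-free types in a substructure are computed in the ambient structure.**
[folklore] -/
theorem eqQFType_substructure_iff {α : Type*} {x y : α → S} :
    L.EqQFType x y ↔ L.EqQFType (Subtype.val ∘ x : α → H) (Subtype.val ∘ y) := by
  constructor
  · intro h φ hφ
    rw [realize_iff_of_isAtomic_substructure S hφ, realize_iff_of_isAtomic_substructure S hφ]
    exact h φ hφ
  · intro h φ hφ
    rw [← realize_iff_of_isAtomic_substructure S hφ, ← realize_iff_of_isAtomic_substructure S hφ]
    exact h φ hφ

variable {S}

/-- A map of the substructure whose underlying map is a partial embedding of `H` on the image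
of `A` is a partial embedding on `A`. [folklore] -/
theorem isQFEmbOn_of_val_comp {g : S → S} {G : H → H} (hgG : ∀ m : S, ((g m : S) : H) = G m)
    {A : Set S} (hG : IsPartialEmbOn L G (Subtype.val '' A)) : IsQFEmbOn L g A := by
  intro n x hx
  rw [eqQFType_substructure_iff S]
  have e : (Subtype.val ∘ g ∘ x : Fin n → H) = G ∘ (Subtype.val ∘ x) := funext fun i => hgG (x i)
  rw [show (Subtype.val ∘ (g ∘ x) : Fin n → H) = G ∘ (Subtype.val ∘ x) from e]
  exact hG (Subtype.val ∘ x) fun i => mem_image_of_mem _ (hx i)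

/-- Conversely, the underlying map of a partial embedding of the substructure on `A` is a partial
embedding of `H` on the image of `A`. [folklore] -/
theorem isPartialEmbOn_image_of_val_comp {g : S → S} {G : H → H}
    (hgG : ∀ m : S, ((g m : S) : H) = G m) {A : Set S} (hg : IsQFEmbOn L g A) :
    IsPartialEmbOn L G (Subtype.val '' A) := by
  intro n x hx
  choose m hmA hmx using hx
  have ex : x = Subtype.val ∘ m := funext fun i => (hmx i).symm
  have eG : G ∘ x = Subtype.val ∘ (g ∘ m) := funext fun i => by
    rw [Function.comp_apply, ← hmx i, ← hgG]; rfl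
  rw [eG, ex]
  exact (eqQFType_substructure_iff S).1 (hg m hmA)

/-- Faces of a family in the substructure, for the restricted closure, are the traces of the
faces in `H`. [folklore] -/
theorem face_restrictCl_eq {cl : Set H → Set H} (bM : ℕ → S) (i : ℕ) :
    face (restrictCl cl (S : Set H)) bM i = Subtype.val ⁻¹' face cl (fun j => (bM j : H)) i := by
  ext m
  simp only [face, mem_restrictCl_iff, mem_preimage, image_image]

/-- Crowns of a family in the substructure are the traces of the crowns in `H`. [folklore] -/
theorem crown_restrictCl_eq {cl : Set H → Set H} (bM : ℕ → S) (T : Finset ℕ) :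
    crown (restrictCl cl (S : Set H)) bM T = Subtype.val ⁻¹' crown cl (fun j => (bM j : H)) T := by
  ext m
  simp only [mem_crown_iff, face_restrictCl_eq, mem_preimage]

end Substructure

/-! ### Crown embeddings inside a member -/

namespace IsQuasiminimalPregeometryClass

variable {L : Language.{v, w}}
variable {𝒞 : ∀ (H : Type u) [L.Structure H], (Set H → Set H) → Prop}
variable {H : Type u} [L.Structure H] {cl : Set H → Set H}

/-- **Partial embeddings on crowns extend, inside a member of the class** (Kirby 2010,
Lemma 3.2 / BHHKK 2014, Prop. 6.2, transferred from `exists_equiv_extend_crown`). Let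
`⟨H, cl⟩ ∈ 𝒞`, `w : ℕ → H` an independent family, `S` a nonempty finite set of indices, and `γ`
a partial embedding of `H` into itself on the crown `⋃_{i ∈ S} ∂ᵢ` (`∂ᵢ = cl (w[ℕ ∖ {i}])`) with
`γ '' ∂ᵢ = ∂ᵢ` (`i ∈ S`) and `γ (w j) = w j` for all `j`. Then there is a bijection `Γ` of `H`,
a partial embedding on the closed countable set `cl (range w)` mapping it onto itself, equal to
`γ` on the crown, fixing every `w j`, and equal to the identity outside `cl (range w)`.
[cite: Kirby2010QMEC, Lemma 3.2] [cite: BHHKK2014, Prop. 6.2] -/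
theorem exists_isPartialEmbOn_extend_crown (h𝒞 : IsQuasiminimalPregeometryClass L 𝒞)
    (hH : 𝒞 H cl) {w : ℕ → H} (hw : IndepFamilyOver cl ∅ w) {S : Finset ℕ} (hS : S.Nonempty)
    {γ : H → H} (hγ : IsPartialEmbOn L γ (crown cl w S))
    (hγF : ∀ i ∈ S, γ '' face cl w i = face cl w i) (hγw : ∀ j, γ (w j) = w j) :
    ∃ Γ : H → H, Function.Bijective Γ ∧ IsPartialEmbOn L Γ (cl (range w)) ∧
      Γ '' cl (range w) = cl (range w) ∧ (∀ z ∈ crown cl w S, Γ z = γ z) ∧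
      (∀ j, Γ (w j) = w j) ∧ ∀ z, z ∉ cl (range w) → Γ z = z := by
  classical
  have hP := h𝒞.isPregeometry hH
  obtain ⟨Sub, hSub, hmem⟩ := h𝒞.cl_mem hH (range w)
  have hWM := h𝒞.isWeaklyQuasiminimalPregeometryStructure hmem
  have hSc : ((Sub : Set H)).Countable := by
    rw [hSub]; exact hP.countable_cl (h𝒞.countable_cl hH) (countable_range w)
  haveI : Countable Sub := hSc.to_subtype
  have hfaceS : ∀ i, face cl w i ⊆ (Sub : Set H) := fun i => by
    rw [hSub]; exact hP.mono (image_subset_range _ _)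
  have hcrownS : crown cl w S ⊆ (Sub : Set H) := fun z hz => by
    obtain ⟨i, -, hz⟩ := mem_crown_iff.1 hz
    exact hfaceS i hz
  have hwS : ∀ j, w j ∈ (Sub : Set H) := fun j => by
    rw [hSub]; exact hP.subset_cl _ (mem_range_self j)
  -- the basis of the substructure
  let bM : ℕ → Sub := fun j => ⟨w j, hwS j⟩
  have hbMw : (fun j => ((bM j : Sub) : H)) = w := rfl
  have hbM : IndepFamilyOver (restrictCl cl (Sub : Set H)) ∅ bM := by
    intro i hi
    rw [empty_union, mem_restrictCl_iff, image_image] at hi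
    exact hw i (by rwa [empty_union])
  have hspM : restrictCl cl (Sub : Set H) (range bM) = univ := by
    refine eq_univ_of_forall fun m => ?_
    rw [mem_restrictCl_iff]
    have h1 : (m : H) ∈ cl (range w) := by rw [← hSub]; exact m.2
    refine hP.mono ?_ h1
    rintro _ ⟨j, rfl⟩
    exact ⟨bM j, mem_range_self j, rfl⟩
  -- the restriction of `γ`
  have hγS : ∀ z ∈ crown cl w S, γ z ∈ (Sub : Set H) := fun z hz => by
    obtain ⟨i, hi, hz⟩ := mem_crown_iff.1 hz
    exact hfaceS i (by rw [← hγF i hi]; exact mem_image_of_mem γ hz)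
  let γM : Sub → Sub := fun m => if hm : (m : H) ∈ crown cl w S then ⟨γ m, hγS _ hm⟩ else m
  let γH : H → H := fun z => if z ∈ crown cl w S then γ z else z
  have hγMH : ∀ m : Sub, ((γM m : Sub) : H) = γH m := fun m => by
    by_cases hm : (m : H) ∈ crown cl w S
    · simp only [γM, γH, dif_pos hm, if_pos hm]
    · simp only [γM, γH, dif_neg hm, if_neg hm]
  have hγHγ : EqOn γH γ (crown cl w S) := fun z hz => if_pos hz
  have hγM : IsQFEmbOn L γM (crown (restrictCl cl (Sub : Set H)) bM S) := by
    refine isQFEmbOn_of_val_comp hγMH ?_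
    rw [crown_restrictCl_eq, hbMw]
    refine (hγ.congr (hγHγ.symm)).mono ?_
    rintro _ ⟨m, hm, rfl⟩
    exact hm
  have hγMF : ∀ i ∈ S, γM '' face (restrictCl cl (Sub : Set H)) bM i =
      face (restrictCl cl (Sub : Set H)) bM i := by
    intro i hi
    rw [face_restrictCl_eq, hbMw]
    ext m
    constructor
    · rintro ⟨m', hm', rfl⟩
      have hm'c : (m' : H) ∈ crown cl w S := face_subset_crown hi hm'
      show ((γM m' : Sub) : H) ∈ face cl w i
      rw [hγMH, hγHγ hm'c, ← hγF i hi]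
      exact mem_image_of_mem γ hm'
    · intro hm
      have hm' : (m : H) ∈ γ '' face cl w i := by rw [hγF i hi]; exact hm
      obtain ⟨z, hz, hzm⟩ := hm'
      have hzc : z ∈ crown cl w S := face_subset_crown hi hz
      refine ⟨⟨z, hfaceS i hz⟩, hz, Subtype.ext ?_⟩
      rw [hγMH, hγHγ hzc]
      exact hzm
  have hγMb : ∀ j, γM (bM j) = bM j := by
    intro j
    apply Subtype.ext
    rw [hγMH]
    by_cases h : w j ∈ crown cl w S
    · show γH (w j) = w j
      rw [hγHγ h, hγw j]
    · show γH (w j) = w j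
      exact if_neg h
  -- the automorphism of the substructure
  obtain ⟨ΓM, hΓM, hΓMγ, hΓMb⟩ := hWM.exists_equiv_extend_crown hbM hspM hS hγM hγMF hγMb
  -- extended by the identity
  let Γ : H → H := fun z => if hz : z ∈ (Sub : Set H) then (ΓM ⟨z, hz⟩ : H) else z
  have hΓin : ∀ (z : H) (hz : z ∈ (Sub : Set H)), Γ z = (ΓM ⟨z, hz⟩ : H) := fun z hz => dif_pos hz
  have hΓout : ∀ z, z ∉ (Sub : Set H) → Γ z = z := fun z hz => dif_neg hz
  have hΓval : ∀ m : Sub, ((ΓM m : Sub) : H) = Γ m := fun m => by rw [hΓin m m.2]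
  have hΓemb : IsPartialEmbOn L Γ (Sub : Set H) := by
    have := isPartialEmbOn_image_of_val_comp hΓval (hΓM.mono (subset_univ (univ : Set Sub)))
    rwa [image_univ, Subtype.range_coe] at this
  have hΓimg : Γ '' (Sub : Set H) = Sub := by
    apply Subset.antisymm
    · rintro _ ⟨z, hz, rfl⟩
      rw [hΓin z hz]; exact Subtype.mem _
    · intro z hz
      obtain ⟨m, hm⟩ := ΓM.surjective ⟨z, hz⟩
      refine ⟨m, m.2, ?_⟩
      rw [hΓin m m.2]
      have : ΓM ⟨m, m.2⟩ = ⟨z, hz⟩ := by simpa using hm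
      rw [this]
  have hΓbij : Function.Bijective Γ := by
    constructor
    · intro a c hac
      by_cases ha : a ∈ (Sub : Set H)
      · by_cases hc : c ∈ (Sub : Set H)
        · exact hΓemb.injOn ha hc hac
        · exfalso
          rw [hΓout c hc] at hac
          have : Γ a ∈ (Sub : Set H) := hΓimg ▸ mem_image_of_mem Γ ha
          rw [hac] at this
          exact hc this
      · by_cases hc : c ∈ (Sub : Set H)
        · exfalso
          rw [hΓout a ha] at hac
          have : Γ c ∈ (Sub : Set H) := hΓimg ▸ mem_image_of_mem Γ hc
          rw [← hac] at this
          exact ha this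
        · rwa [hΓout a ha, hΓout c hc] at hac
    · intro c
      by_cases hc : c ∈ (Sub : Set H)
      · have : c ∈ Γ '' (Sub : Set H) := hΓimg.symm ▸ hc
        obtain ⟨a, -, rfl⟩ := this
        exact ⟨a, rfl⟩
      · exact ⟨c, hΓout c hc⟩
  refine ⟨Γ, hΓbij, by rw [← hSub]; exact hΓemb, by rw [← hSub]; exact hΓimg, ?_, ?_, ?_⟩
  · intro z hz
    rw [hΓin z (hcrownS hz)]
    have hzM : (⟨z, hcrownS hz⟩ : Sub) ∈ crown (restrictCl cl (Sub : Set H)) bM S := by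
      rw [crown_restrictCl_eq, hbMw]; exact hz
    rw [hΓMγ _ hzM, hγMH, hγHγ hz]
  · intro j
    rw [hΓin (w j) (hwS j)]
    exact congr_arg Subtype.val (hΓMb j)
  · intro z hz
    exact hΓout z (by rwa [hSub])

end IsQuasiminimalPregeometryClass

end Literature.ModelTheory.Quasiminimal

end
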